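import Summits.AtomisticToContinuum.BoseEinsteinCondensation.Theorems.BECGroundStateSOSPeriodicIRBoundTwoSectorFloatingDefs
import HarnessLib

/-!
# Strategist s2 — typed companion of `STRATEGY-CENSUS.md` v3 for crux `PeriodicIRBound`
# (stmt-AtomisticToContinuum-3972, route BECGroundStateSOS)

Seat `planner-cstrat-stmt-AtomisticToContinuum-3972-s2-0`, 2026-08-17. Everything here elaborates against the tree as it
stands after lead c22's v8 skeleton (`Lines/two_sector_gd_transfer.lean`: open stubs S1' `FloatingTwoChannel`, S6
`NonIntegrableHalf`). Nothing in this file is a stub of a registered line; it types the objects the census talks about: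

* §1 `MeanFloorPlus` / `MeanFloorMinus` and `meanFloorPlus_of_chanPlus` / `meanFloorMinus_of_chanMinus`: the channel
  inequalities of S1' are FIRST-MOMENT ("mean") Landau floors on the KLS test vectors — `ChanPlus … T b` forces the mean
  energy of `a†(φ_n)ψ` above `T` to be at least `‖a†ψ‖²/b = (n_k+1)‖n‖²/(CL²)` (census §1: S1' = X + "location").
* §2 `kls_from_shares`: the scalar content of Kennedy–Lieb–Shastry — the two channel shares give the quadratic
  inequality the landed endgame consumes; the converse (X ⇒ shares) is false at the scalar level (census §Negation N5).
* §3 `FloatingForRelaxed` / `FloatingTwoChannelRelaxed` (guard `−A·ρ ≤ μ₊` instead of `0 ≤ μ₊`) with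
  `floatingForRelaxed_of_floatingFor`: the relaxation under which line 1's pooled target `C⁺ = LinearParticleHoleFloor`
  implies S1' (census §Transfer T10 / §Strengthen S⁺7); typed target `LinearFloorGivesFloating` (statement only).
-/

noncomputable section

open scoped BigOperators ENNReal
open Filter MeasureTheory

namespace Summit.AtomisticToContinuum.BoseEinsteinCondensation.Cruxes.PeriodicIRBound.StrategistS2

open Literature.MathematicalPhysics.QuantumManyBody.BoseGas
open Summit.AtomisticToContinuum.BoseEinsteinCondensation.Cruxes.PeriodicIRBound.TwoSectorGdTransfer
  (NearMinAt ChanPlus ChanMinus FloatingFor FloatingTwoChannel)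
open Summit.AtomisticToContinuum.BoseEinsteinCondensation.Cruxes.PeriodicIRBound.LinearPhFloorWagner
  (LinearFloorFor LinearParticleHoleFloor WF.qform)

/-! ## §1 The channel inequalities as first-moment Landau floors -/

/-- **Mean (first-moment) particle-addition floor `θ` above threshold `T`** at near-minimisers of `H_{m+2}`: for every
`η > 0` there is `δ > 0` such that every `δ`-near-minimiser `Ψ` obeys `θ·‖a†(φ_n)ψ‖² ≤ (1+η)(𝓔[a†ψ] − T‖a†ψ‖²) + η‖a†ψ‖²`
(`‖a†ψ‖² = n_k + 1`), i.e. the mean energy of the particle-addition test vector exceeds `T` by at least `θ` up to the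
regularisation. The infimum version (spectral edge instead of mean) is line 1's `LinearFloorFor`. [folklore] -/
def MeanFloorPlus (v : ℝ → ℝ≥0∞) (m : ℕ) (L : ℝ) (n : Fin 3 → ℤ) (T θ : ℝ) : Prop :=
  ∀ η : ℝ, 0 < η → ∃ δ : ℝ≥0∞, 0 < δ ∧ ∀ Ψ : PeriodicTrialState (m + 2) L, NearMinAt v δ Ψ →
    let nk : ℝ := (cellOccupation (m + 2) L (planeWaveMode L n) Ψ.ψ).toReal
    let qC : ℝ := (WF.qform v L (modeCr (planeWaveMode L n) Ψ.ψ)).toReal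
    θ * (nk + 1) ≤ (1 + η) * (qC - T * (nk + 1)) + η * (nk + 1)

/-- **Mean particle-removal floor `θ` above threshold `T`** (`‖a(φ_n)ψ‖² = n_k`). [folklore] -/
def MeanFloorMinus (v : ℝ → ℝ≥0∞) (m : ℕ) (L : ℝ) (n : Fin 3 → ℤ) (T θ : ℝ) : Prop :=
  ∀ η : ℝ, 0 < η → ∃ δ : ℝ≥0∞, 0 < δ ∧ ∀ Ψ : PeriodicTrialState (m + 2) L, NearMinAt v δ Ψ →
    let nk : ℝ := (cellOccupation (m + 2) L (planeWaveMode L n) Ψ.ψ).toReal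
    let qA : ℝ := (WF.qform v L (modeAn L (planeWaveMode L n) Ψ.ψ)).toReal
    θ * nk ≤ (1 + η) * (qA - T * nk) + η * nk

/-- `ChanPlus … T b` with `b > 0` contains the uniform mean floor `1/b = ‖n‖²/(CL²)` (`= ε_k/(4π²C)`): from
`(n_k+1)² ≤ b·RHS` and `n_k + 1 ≥ 1`. At `v = 0` the mean addition energy is exactly `ε_k` (c22's
`FloatingSharp.qform_modeCr_conden`), which is why `C ≥ 1/(4π²)` is forced. [folklore] -/
theorem meanFloorPlus_of_chanPlus {v : ℝ → ℝ≥0∞} {m : ℕ} {L : ℝ} {n : Fin 3 → ℤ} {T b : ℝ} (hb : 0 < b)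
    (h : ChanPlus v m L n T b) : MeanFloorPlus v m L n T (1 / b) := by
  intro η hη
  obtain ⟨δ, hδ, hΨ⟩ := h η hη
  refine ⟨δ, hδ, fun Ψ hnear => ?_⟩
  have key := hΨ Ψ hnear
  simp only at key ⊢
  set nk : ℝ := (cellOccupation (m + 2) L (planeWaveMode L n) Ψ.ψ).toReal with hnk_def
  set R : ℝ := (1 + η) * ((WF.qform v L (modeCr (planeWaveMode L n) Ψ.ψ)).toReal - T * (nk + 1)) + η * (nk + 1)
    with hR
  have hnk : 0 ≤ nk := ENNReal.toReal_nonneg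
  have h1 : 1 ≤ nk + 1 := by linarith
  -- (nk+1)² ≤ b R and nk + 1 ≥ 1 give (nk+1) ≤ b R, i.e. (1/b)(nk+1) ≤ R
  have h2 : (nk + 1) ≤ b * R := by nlinarith [key, h1]
  have h3 : (1 / b) * (nk + 1) ≤ R := by
    rw [div_mul_eq_mul_div, one_mul, div_le_iff₀ hb]
    linarith [h2, mul_comm b R]
  exact h3

/-- `ChanMinus … T b` with `b > 0` contains the mean removal floor `n_k/b` per unit norm, hence (using only `n_k² ≤ b·RHS`)
the floor `θ = 0` trivially and `θ = 1/b` once `n_k ≥ 1`; we record the scale-free form `n_k·(n_k/b) ≤ RHS`. [folklore] -/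
theorem meanFloorMinus_of_chanMinus {v : ℝ → ℝ≥0∞} {m : ℕ} {L : ℝ} {n : Fin 3 → ℤ} {T b : ℝ} (hb : 0 < b)
    (h : ChanMinus v m L n T b) :
    ∀ η : ℝ, 0 < η → ∃ δ : ℝ≥0∞, 0 < δ ∧ ∀ Ψ : PeriodicTrialState (m + 2) L, NearMinAt v δ Ψ →
      let nk : ℝ := (cellOccupation (m + 2) L (planeWaveMode L n) Ψ.ψ).toReal
      let qA : ℝ := (WF.qform v L (modeAn L (planeWaveMode L n) Ψ.ψ)).toReal
      (nk / b) * nk ≤ (1 + η) * (qA - T * nk) + η * nk := by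
  intro η hη
  obtain ⟨δ, hδ, hΨ⟩ := h η hη
  refine ⟨δ, hδ, fun Ψ hnear => ?_⟩
  have key := hΨ Ψ hnear
  simp only at key ⊢
  rw [div_mul_eq_mul_div, div_le_iff₀ hb]
  nlinarith [key]

/-! ## §2 The scalar content of KLS: shares ⇒ the quadratic inequality (the converse is false) -/

/-- **Shares give the KLS quadratic inequality.** If the particle channel carries its share `(n+1)² ≤ bP` and the hole
channel its share `n² ≤ bM`, then `(2n+1)² ≤ 2b(P+M)`; `P + M` is pinned by the f-sum (double commutator) up to the
chemical-potential terms, which is all the landed endgame (`KLSMomentForT`, `WindowAssemblyT`) uses. The census (§1, N5)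
records why the converse direction — recovering the two shares from the quadratic inequality, i.e. S1' from X — has no
soft proof: the variational bounds `P ≥ (μ_N⁺ − μ₊)(n+1)`, `M ≥ (μ₋ − μ_N⁻)n` supply total share at most
`(Δ²E₀(N) + slack)(n+1)`, far below `(2n²+2n+1)/b`. [folklore] -/
theorem kls_from_shares {n b P M : ℝ} (hP : (n + 1) ^ 2 ≤ b * P) (hM : n ^ 2 ≤ b * M) :
    (2 * n + 1) ^ 2 ≤ 2 * b * (P + M) := by
  nlinarith [hP, hM, sq_nonneg n, sq_nonneg (n + 1)]

/-- The total share two floating thresholds can extract from the VARIATIONAL principle alone: with forward/backward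
increments `μp0 = E₀(N+1) − E₀(N)`, `μm0 = E₀(N) − E₀(N−1)`, thresholds `μ₊ ≤ μp0`, `μ₋ ≥ μm0` coupled by
`μ₋ ≤ μ₊ + e`, the variational channel gaps `(μp0 − μ₊)` and `(μ₋ − μm0)` sum to at most the convexity excess plus the
slack, `μp0 − μm0 + e`. [folklore] -/
theorem variational_share_le {μp0 μm0 μp μm e : ℝ} (hcouple : μm ≤ μp + e) :
    (μp0 - μp) + (μm - μm0) ≤ (μp0 - μm0) + e := by
  linarith

/-! ## §3 The relaxed guard and the arrow `C⁺ ⇒ S1'` -/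

/-- **`FloatingFor` with the guard `0 ≤ μ₊` relaxed to `−A·ρ ≤ μ₊`.** The landed endgame absorbs `−μ₊ ≤ Aρ` into the
f-sum constant (`2N‖v‖₁/L³ = 2ρ‖v‖₁` is already there), so S4'/S5' go through with `C‖v‖₁ ↦ C‖v‖₁ + A/2`-type
constants (paper; census §Strengthen S⁺7). With this guard, line 1's `LinearFloorFor v` (C⁺) implies the floating
two-channel bound for `v` (census §Transfer T10: Wagner's two-sided bound gives X, then the yrast floors place a common
`μ` with both shares; the strict guard would need in addition a quantitative PARTICLE-side gap `E_{N+1}(k) − E₀(N) ≥ (n+1)/b`,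
which C⁺ does not assert). A statement of a proof plan, not a result in print. -/
def FloatingForRelaxed (v : ℝ → ℝ≥0∞) (K ρ₀ C A : ℝ) : Prop :=
  ∀ ε : ℝ, 0 < ε → ∀ ρ : ℝ, 0 < ρ → ρ < ρ₀ → ∀ᶠ m : ℕ in atTop,
    ∀ n : Fin 3 → ℤ, n ≠ 0 → 2 * Real.pi / sideLength ρ (m + 2) * ‖(fun j => (n j : ℝ))‖ ≤ K →
      ∃ μp μm : ℝ, -(A * ρ) ≤ μp ∧
        μm ≤ μp + ε * Real.sqrt (ρ * (scatteringLength v).toReal) / sideLength ρ (m + 2) ∧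
        ChanPlus v m (sideLength ρ (m + 2)) n
            ((periodicGroundStateEnergy v (m + 2) (sideLength ρ (m + 2))).toReal + μp)
            (C * sideLength ρ (m + 2) ^ 2 / ‖(fun j => (n j : ℝ))‖ ^ 2) ∧
          ChanMinus v m (sideLength ρ (m + 2)) n
            ((periodicGroundStateEnergy v (m + 2) (sideLength ρ (m + 2))).toReal - μm)
            (C * sideLength ρ (m + 2) ^ 2 / ‖(fun j => (n j : ℝ))‖ ^ 2)

/-- S1' with the relaxed guard: every integrable admissible `v` admits data `K, ρ₀, C > 0`, `A ≥ 0`. -/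
def FloatingTwoChannelRelaxed : Prop :=
  ∀ v : ℝ → ℝ≥0∞, IsRepulsiveFiniteRange v → (∫⁻ x : Space, v ‖x‖) ≠ ⊤ →
    ∃ K : ℝ, 0 < K ∧ ∃ ρ₀ : ℝ, 0 < ρ₀ ∧ ∃ C : ℝ, 0 < C ∧ ∃ A : ℝ, 0 ≤ A ∧ FloatingForRelaxed v K ρ₀ C A

/-- The strict guard implies the relaxed one (any `A ≥ 0`). [folklore] -/
theorem floatingForRelaxed_of_floatingFor {v : ℝ → ℝ≥0∞} {K ρ₀ C A : ℝ} (hA : 0 ≤ A)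
    (h : FloatingFor v K ρ₀ C) : FloatingForRelaxed v K ρ₀ C A := by
  intro ε hε ρ hρ hρρ₀
  filter_upwards [h ε hε ρ hρ hρρ₀] with m hm n hn hK
  obtain ⟨μp, μm, hμp, hμm, hP, hM⟩ := hm n hn hK
  exact ⟨μp, μm, by nlinarith [mul_nonneg hA hρ.le], hμm, hP, hM⟩

/-- S1' implies its relaxed form. [folklore] -/
theorem floatingTwoChannelRelaxed_of_floatingTwoChannel (h : FloatingTwoChannel) : FloatingTwoChannelRelaxed := by
  intro v hv hint
  obtain ⟨K, hK, ρ₀, hρ₀, C, hC, hF⟩ := h v hv hint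
  exact ⟨K, hK, ρ₀, hρ₀, C, hC, 0, le_rfl, floatingForRelaxed_of_floatingFor le_rfl hF⟩

/-- **Typed target (statement only; census §Transfer T10): line 1's pooled target implies line 2's pooled target.**
For an integrable admissible `v` with `∫v ≠ 0`, `LinearFloorFor v` (C⁺: `2E₀(N) + 2θ√ρ‖p‖ ≤ E_{N+1}(p) + E_{N−1}(p)` on
`‖p‖² ≤ Cρ`) gives `FloatingForRelaxed v K ρ₀ C' A` for suitable data. Paper proof: (1) C⁺ ⇒ `IRBoundFor v` with some
`C_X` (LANDED: `Transfer`, `stub_wagnerFeynman`, `TransferArith`); (2) momentum-zero normal form (LANDED p156444): the test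
vectors `a†(φ_n)Ψ₀`, `a(φ_n)Ψ₀` lie in the sectors `±p`, so `𝓔[a†Ψ₀] ≥ E_{N+1}(p)(n+1)`, `𝓔[aΨ₀] ≥ E_{N−1}(p)·n`;
(3) with `b = C'L²/‖n‖²` and `C' ≥ (2C_X + κ)/(4πθ)` one has `(2n+1)/b ≤ 2θ√ρ‖p‖ ≤ G := E_{N+1}(p) + E_{N−1}(p) − 2E₀`, so
the interval `[E₀ − E_{N−1}(p) + n/b, E_{N+1}(p) − E₀ − (n+1)/b]` is non-empty; any `μ₊ = μ₋ = μ` in it gives both shares,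
hence `ChanPlus`/`ChanMinus` (near-minimiser bookkeeping as in S4'); (4) `μ ≥ −(n+1)/b ≥ −A·ρ` on the window
(`E_{N+1}(p) ≥ E₀(N+1) ≥ E₀(N)`, monotonicity landed), which is where the relaxed guard is used. For `∫v = 0` S1' holds
outright (LANDED p154826). Not a result in print. -/
def LinearFloorGivesFloating : Prop :=
  ∀ v : ℝ → ℝ≥0∞, IsRepulsiveFiniteRange v → (∫⁻ x : Space, v ‖x‖) ≠ ⊤ → (∫⁻ x : Space, v ‖x‖) ≠ 0 →
    LinearFloorFor v → ∃ K : ℝ, 0 < K ∧ ∃ ρ₀ : ℝ, 0 < ρ₀ ∧ ∃ C : ℝ, 0 < C ∧ ∃ A : ℝ, 0 ≤ A ∧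
      FloatingForRelaxed v K ρ₀ C A

end Summit.AtomisticToContinuum.BoseEinsteinCondensation.Cruxes.PeriodicIRBound.StrategistS2

end
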